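import Summits.ValiantsHypothesis.ValiantsHypothesis.Theorems.KPlusLogSqLawTropicalSymmetricThreeFourFifteenMirror
import Summits.ValiantsHypothesis.ValiantsHypothesis.Theorems.KPlusLogSqLawTropicalSymmetricThreeFourWindow

/-!
# Route «KPlusLogSqLaw» — the SYMMETRIC `(3,4)` tropical row SETTLED in the kernel: `T^single_sym(3,4) = 15`
# (`T_sym(3,4) ≤ 15` ON EVERY SUPPORT, face-free; with the floor p469079 the row predicate `TropRootLawAtSymm 3 4 B` holds iff `15 ≤ B`)

HONEST FRAMING.  Helper file (seat val-sym-lift-p2 (g6), cell `pub-symmetroid`, 2026-08-27; `--supports` the `WeakLifting` item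
stmt-ValiantsHypothesis-19561 as a helper, no closure claim).  A SMALL-FORMAT statement in the single-term-carrier tropical model of the
tree (`IsDominant`), far inside the known regime of the cruxes; a tropical count constrains Viro-type constructions only, not real pencils.
Nothing here is about `TropicalB` (stmt-19771) / `WeakLifting` (stmt-19561) in their windows, Conjecture B, the real census numeral of Door A
at `(3,4)` (`PosRootLawAt 3 4 18`, stmt-19980, OPEN, never asserted), `MatrixDescartes` (stmt-ValiantsHypothesis-18050) or VP ≠ VNP.

STATEMENT (`tropRow_three_four_symm_le_fifteen`, the EXACT shape of `tropRow_three_four_symm_le` (p459728) with `15`): for exponents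
`d : Fin 4 → ℕ` (any support), SYMMETRIC `v ε : Fin 3 → Fin 3 → Fin 4 → ℤ` and a chain of `n + 1` uniquely dominant terms at strictly
increasing integer slopes with alternating signs, `n ≤ 15`.  With the floor `15` on `d = (0,1,4,13)` (p469079) this is SHARP:
`tropRootLawAtSymm_three_four_iff : TropRootLawAtSymm 3 4 B ↔ 15 ≤ B` — the kernel window `[15, 18] → [15, 17] → [15, 16]` (p459728,
p481791, p484569) closes at the cell value `15` (theory-2 g19 σ-state DP ‖ lift-p2 g5 pairwise DP ‖ this seat's carrier enumeration).

PROOF (face-free; «LEMMA Z»).  Relabel classes by a SORTING BIJECTION of the exponents (`Tuple.sort`, so that diagonal sign letters keep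
their identity under relabelling) and pass to the abstract core `SymmetricThreeFourFifteen.core`: a 17-term chain misses exactly three rank
multisets (`…Sixteen.core`), and the exclusion lemmas X1/X2/Y1/Y2 (p484117) + W1/W2/V2 (this seat) leave two mirror-image possibilities —
misses `{0,0,3}, {0,1,3}` (Family A) or `{0,2,3}, {0,3,3}` (Family B).  In Family A the terms carrying `{0,1,2} = D(u)`, `{1,1,2}`, `{0,2,2}`,
`{1,2,2}` are forced to be `D(u), T_{κ2}(2;1), T_{κ0}(0;2), T_{κ1}(1;2)` (each crossing term fixes the column where `u` carries its own
fixed rank) at four CONSECUTIVE positions (`carriers`, `window`); the product of their four signs is `−(∏_k ε_kk(u_k))²·∏ε_ij² < 0`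
(`termSign_one_eq`, `termSign_swap_symm_three`), contradicting alternation (`parity`).  Family B is the mirror image (`familyB`).
[cell statement R1668/R1671 «Lemma Z = successor target»; folklore-level exchange and sign arguments, no citation exists]
-/

set_option linter.dupNamespace false
set_option autoImplicit false

namespace Summit.ValiantsHypothesis.ValiantsHypothesis.Theorems.KPlusLogSqLaw

open Summit.ValiantsHypothesis.ValiantsHypothesis.Theorems.MatrixDescartes.Negative
open Summit.ValiantsHypothesis.ValiantsHypothesis.Theorems.LacunarySymmetroidMatrixDescartes
open Summit.ValiantsHypothesis.ValiantsHypothesis.Theorems.LacunarySymmetroidMatrixDescartes.TropicalCensus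
open Finset

namespace SymmetricThreeFourFifteen

open SymmetricThreeFour SymmetricThreeFourSeventeen SymmetricThreeFourSixteen

/-- distinct count vectors give distinct patterns. -/
theorem pat_ne (w w' : Fin 3 → Fin 4)
    (h : (fun l : Fin 4 => (univ.filter fun i : Fin 3 => w i = l).card) ≠ fun l => (univ.filter fun i : Fin 3 => w' i = l).card) :
    TropicalCensus.classSym ((1 : Equiv.Perm (Fin 3)), w) ≠ TropicalCensus.classSym ((1 : Equiv.Perm (Fin 3)), w') :=
  fun heq => h (counts_eq_of_classSym_eq heq)

/-- **CORE (face-free), fifteen.**  Terms `r₀, …, r_n` of `S₃ × (Fin 3 → Fin 4)` (classes = exponent ranks) with cycle-constant class maps on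
involutive carriers, same-row monotonicity, pairwise distinct class multisets, strictly increasing slopes for monotone rank exponents `g`,
the two crossing cancellation rules, and SIGN data (`s a` = sign of the `a`-th term, `A k c` = sign of the diagonal letter of rank `c` at
column `k`: identity terms have sign `∏_k A k (u k)`, a crossing term fixing column `k` has the sign of `−A k (rank at k)`, consecutive signs
alternate).  Then `n ≤ 15`. [Lemma Z; counting + `lemmaW1/W2/V2` + `familyA/B`] -/
theorem core (n : ℕ) (r : Fin (n + 1) → Equiv.Perm (Fin 3) × (Fin 3 → Fin 4)) (g : Fin 4 → ℕ) (hmono : Monotone g)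
    (s : Fin (n + 1) → ℤ) (A : Fin 3 → Fin 4 → ℤ)
    (h1 : ∀ k i, (r k).2 ((r k).1 i) = (r k).2 i)
    (hinv : ∀ k i, (r k).1 ((r k).1 i) = i)
    (h2 : ∀ a b : Fin (n + 1), a < b → ∀ i, (r a).1 i = (r b).1 i → (r a).2 i ≤ (r b).2 i)
    (h3 : Function.Injective fun k => TropicalCensus.classSym (r k))
    (hS : ∀ a b : Fin (n + 1), a < b → TropicalCensus.slope g (r a) < TropicalCensus.slope g (r b))
    (h6 : ∀ a b : Fin (n + 1), a < b → (r a).1 = 1 → ∀ i j : Fin 3, i ≠ j → (r b).1 i = j → (r b).1 j = i →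
      g ((r a).2 i) + g ((r a).2 j) < 2 * g ((r b).2 i))
    (h7 : ∀ a b : Fin (n + 1), a < b → (r b).1 = 1 → ∀ i j : Fin 3, i ≠ j → (r a).1 i = j → (r a).1 j = i →
      2 * g ((r a).2 i) < g ((r b).2 i) + g ((r b).2 j))
    (hD : ∀ a, (r a).1 = 1 → s a = ∏ k, A k ((r a).2 k))
    (hT : ∀ (a : Fin (n + 1)) (k : Fin 3), (r a).1 ≠ 1 → (r a).1 k = k → ∀ t : ℤ, s a * t < 0 ↔ -A k ((r a).2 k) * t < 0)
    (halt : ∀ k : Fin n, s k.castSucc * s k.succ < 0) : n ≤ 15 := by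
  have h8 : ∀ (a b : Fin (n + 1)) (i j : Fin 3), (r a).2 i ≤ (r b).2 j → g ((r a).2 i) ≤ g ((r b).2 j) :=
    fun a b i j h => hmono h
  by_contra hn
  have hn16 : n ≤ 16 := SymmetricThreeFourSixteen.core n r g h1 h2 h3 h6 h7 h8
  have X1 := lemmaX1 r g h1 h2 h6 h8
  have X2 := lemmaX2 r g h1 h2 h7 h8
  have Y1 := lemmaY1 r g h1 h2 h6 h7 h8
  have Y2 := lemmaY2 r g h1 h2 h6 h7 h8
  classical
  let P : (Fin 3 → Fin 4) → Sym (Fin 4) 3 := fun w => TropicalCensus.classSym ((1 : Equiv.Perm (Fin 3)), w)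
  -- the three missed multisets (as in `…Sixteen.core`)
  obtain ⟨X, hX, hXmiss⟩ : ∃ X, (X = P ![0, 0, 3] ∨ X = P ![0, 1, 2]) ∧ ∀ k, TropicalCensus.classSym (r k) ≠ X := by
    by_cases hA : ∃ a, TropicalCensus.classSym (r a) = P ![0, 0, 3]
    · obtain ⟨a, ha⟩ := hA
      exact ⟨P ![0, 1, 2], Or.inr rfl, fun b hb => X1 a b ha hb⟩
    · push Not at hA
      exact ⟨P ![0, 0, 3], Or.inl rfl, hA⟩
  obtain ⟨Y, hY, hYmiss⟩ : ∃ Y, (Y = P ![0, 3, 3] ∨ Y = P ![1, 2, 3]) ∧ ∀ k, TropicalCensus.classSym (r k) ≠ Y := by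
    by_cases hA : ∃ a, TropicalCensus.classSym (r a) = P ![0, 3, 3]
    · obtain ⟨a, ha⟩ := hA
      exact ⟨P ![1, 2, 3], Or.inr rfl, fun b hb => X2 a b ha hb⟩
    · push Not at hA
      exact ⟨P ![0, 3, 3], Or.inl rfl, hA⟩
  obtain ⟨Z, hZ, hZmiss⟩ : ∃ Z, (Z = P ![0, 1, 3] ∨ Z = P ![1, 1, 2] ∨ Z = P ![0, 2, 3] ∨ Z = P ![1, 2, 2]) ∧
      ∀ k, TropicalCensus.classSym (r k) ≠ Z := by
    by_cases hA : ∃ a, TropicalCensus.classSym (r a) = P ![0, 1, 3]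
    · by_cases hB : ∃ b, TropicalCensus.classSym (r b) = P ![1, 1, 2]
      · by_cases hC : ∃ c, TropicalCensus.classSym (r c) = P ![0, 2, 3]
        · refine ⟨P ![1, 2, 2], Or.inr (Or.inr (Or.inr rfl)), fun e he => ?_⟩
          obtain ⟨a, ha⟩ := hA
          obtain ⟨b, hb⟩ := hB
          obtain ⟨c, hc⟩ := hC
          have y1 := Y1 a b ha hb
          have y2 := Y2 c e hc he
          have g12 : g 1 ≤ g 2 := hmono (by decide)
          omega
        · push Not at hC
          exact ⟨P ![0, 2, 3], Or.inr (Or.inr (Or.inl rfl)), hC⟩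
      · push Not at hB
        exact ⟨P ![1, 1, 2], Or.inr (Or.inl rfl), hB⟩
    · push Not at hA
      exact ⟨P ![0, 1, 3], Or.inl rfl, hA⟩
  have hXY : X ≠ Y := by
    rcases hX with rfl | rfl <;> rcases hY with rfl | rfl <;> exact pat_ne _ _ (by decide)
  have hXZ : X ≠ Z := by
    rcases hX with rfl | rfl <;> rcases hZ with rfl | rfl | rfl | rfl <;> exact pat_ne _ _ (by decide)
  have hYZ : Y ≠ Z := by
    rcases hY with rfl | rfl <;> rcases hZ with rfl | rfl | rfl | rfl <;> exact pat_ne _ _ (by decide)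
  -- the image is exactly the complement of `{X, Y, Z}`: every other multiset is carried
  have hsub : univ.image (fun k => TropicalCensus.classSym (r k)) ⊆ ((univ.erase X).erase Y).erase Z := by
    intro M hM
    obtain ⟨k, -, rfl⟩ := mem_image.mp hM
    exact mem_erase.mpr ⟨hZmiss k, mem_erase.mpr ⟨hYmiss k, mem_erase.mpr ⟨hXmiss k, mem_univ _⟩⟩⟩
  have h20 : Nat.multichoose 4 3 = 20 := by rw [Nat.multichoose_eq]; rfl
  have hcardR : (((univ.erase X).erase Y).erase Z).card = 17 := by
    rw [card_erase_of_mem (mem_erase.mpr ⟨hYZ.symm, mem_erase.mpr ⟨hXZ.symm, mem_univ _⟩⟩),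
      card_erase_of_mem (mem_erase.mpr ⟨hXY.symm, mem_univ _⟩), card_erase_of_mem (mem_univ _), card_univ,
      Sym.card_sym_eq_multichoose, Fintype.card_fin, h20]
  have hcardL : (univ.image fun k => TropicalCensus.classSym (r k)).card = n + 1 := by
    rw [card_image_of_injective _ h3, card_univ, Fintype.card_fin]
  have heq : univ.image (fun k => TropicalCensus.classSym (r k)) = ((univ.erase X).erase Y).erase Z :=
    eq_of_subset_of_card_le hsub (by rw [hcardR, hcardL]; omega)
  have hit : ∀ M, M ≠ X → M ≠ Y → M ≠ Z → ∃ k, TropicalCensus.classSym (r k) = M := by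
    intro M hMX hMY hMZ
    have hM : M ∈ ((univ.erase X).erase Y).erase Z :=
      mem_erase.mpr ⟨hMZ, mem_erase.mpr ⟨hMY, mem_erase.mpr ⟨hMX, mem_univ _⟩⟩⟩
    rw [← heq] at hM
    obtain ⟨k, -, hk⟩ := mem_image.mp hM
    exact ⟨k, hk⟩
  have neX : ∀ w : Fin 3 → Fin 4, P w ≠ P ![0, 0, 3] → P w ≠ P ![0, 1, 2] → P w ≠ X := by
    intro w h h'; rcases hX with rfl | rfl
    · exact h
    · exact h'
  have neY : ∀ w : Fin 3 → Fin 4, P w ≠ P ![0, 3, 3] → P w ≠ P ![1, 2, 3] → P w ≠ Y := by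
    intro w h h'; rcases hY with rfl | rfl
    · exact h
    · exact h'
  -- case analysis on the third miss
  rcases hZ with rfl | rfl | rfl | rfl
  · -- `Z = {0,1,3}`: Family A (or `lemmaV2`)
    obtain ⟨b, hb⟩ := hit (P ![0, 2, 3]) (neX _ (pat_ne _ _ (by decide)) (pat_ne _ _ (by decide)))
      (neY _ (pat_ne _ _ (by decide)) (pat_ne _ _ (by decide))) (pat_ne _ _ (by decide))
    obtain ⟨c, hc⟩ := hit (P ![1, 1, 2]) (neX _ (pat_ne _ _ (by decide)) (pat_ne _ _ (by decide)))
      (neY _ (pat_ne _ _ (by decide)) (pat_ne _ _ (by decide))) (pat_ne _ _ (by decide))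
    obtain ⟨e, he⟩ := hit (P ![1, 2, 2]) (neX _ (pat_ne _ _ (by decide)) (pat_ne _ _ (by decide)))
      (neY _ (pat_ne _ _ (by decide)) (pat_ne _ _ (by decide))) (pat_ne _ _ (by decide))
    obtain ⟨f, hf⟩ := hit (P ![0, 2, 2]) (neX _ (pat_ne _ _ (by decide)) (pat_ne _ _ (by decide)))
      (neY _ (pat_ne _ _ (by decide)) (pat_ne _ _ (by decide))) (pat_ne _ _ (by decide))
    rcases hX with rfl | rfl
    · obtain ⟨a₀, ha⟩ := hit (P ![0, 1, 2]) (pat_ne _ _ (by decide))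
        (neY _ (pat_ne _ _ (by decide)) (pat_ne _ _ (by decide))) (pat_ne _ _ (by decide))
      exact familyA r g hmono s A h1 h2 h3 hS h6 h7 hD hT halt a₀ b c f e ha hb hc hf he hXmiss hZmiss
    · obtain ⟨z, hz⟩ := hit (P ![0, 0, 3]) (pat_ne _ _ (by decide))
        (neY _ (pat_ne _ _ (by decide)) (pat_ne _ _ (by decide))) (pat_ne _ _ (by decide))
      exact lemmaV2 r g h1 h2 h6 h7 h8 (Y2 b e hb he) z b c e hz hb hc he
  · -- `Z = {1,1,2}`: `{0,1,3}, {0,2,3}, {1,2,2}, {2,2,2}` carried — `lemmaY2` + `lemmaW1`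
    obtain ⟨a, ha⟩ := hit (P ![0, 1, 3]) (neX _ (pat_ne _ _ (by decide)) (pat_ne _ _ (by decide)))
      (neY _ (pat_ne _ _ (by decide)) (pat_ne _ _ (by decide))) (pat_ne _ _ (by decide))
    obtain ⟨b, hb⟩ := hit (P ![0, 2, 3]) (neX _ (pat_ne _ _ (by decide)) (pat_ne _ _ (by decide)))
      (neY _ (pat_ne _ _ (by decide)) (pat_ne _ _ (by decide))) (pat_ne _ _ (by decide))
    obtain ⟨e, he⟩ := hit (P ![1, 2, 2]) (neX _ (pat_ne _ _ (by decide)) (pat_ne _ _ (by decide)))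
      (neY _ (pat_ne _ _ (by decide)) (pat_ne _ _ (by decide))) (pat_ne _ _ (by decide))
    obtain ⟨q, hq⟩ := hit (P ![2, 2, 2]) (neX _ (pat_ne _ _ (by decide)) (pat_ne _ _ (by decide)))
      (neY _ (pat_ne _ _ (by decide)) (pat_ne _ _ (by decide))) (pat_ne _ _ (by decide))
    exact lemmaW1 r g h1 hinv h2 h6 h7 h8 (Y2 b e hb he) a q ha hq
  · -- `Z = {0,2,3}`: Family B (mirror)
    refine familyB r g hmono s A h1 h2 h3 hS h6 h7 hD hT halt ?_ ?_ ?_ ?_ hZmiss ?_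
    · exact hit (P ![0, 1, 3]) (neX _ (pat_ne _ _ (by decide)) (pat_ne _ _ (by decide)))
        (neY _ (pat_ne _ _ (by decide)) (pat_ne _ _ (by decide))) (pat_ne _ _ (by decide))
    · exact hit (P ![1, 1, 2]) (neX _ (pat_ne _ _ (by decide)) (pat_ne _ _ (by decide)))
        (neY _ (pat_ne _ _ (by decide)) (pat_ne _ _ (by decide))) (pat_ne _ _ (by decide))
    · exact hit (P ![1, 2, 2]) (neX _ (pat_ne _ _ (by decide)) (pat_ne _ _ (by decide)))
        (neY _ (pat_ne _ _ (by decide)) (pat_ne _ _ (by decide))) (pat_ne _ _ (by decide))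
    · exact hit (P ![1, 1, 3]) (neX _ (pat_ne _ _ (by decide)) (pat_ne _ _ (by decide)))
        (neY _ (pat_ne _ _ (by decide)) (pat_ne _ _ (by decide))) (pat_ne _ _ (by decide))
    · rcases hY with rfl | rfl
      · exact Or.inr ⟨hYmiss, hit (P ![1, 2, 3]) (neX _ (pat_ne _ _ (by decide)) (pat_ne _ _ (by decide)))
          (pat_ne _ _ (by decide)) (pat_ne _ _ (by decide))⟩
      · exact Or.inl (hit (P ![0, 3, 3]) (neX _ (pat_ne _ _ (by decide)) (pat_ne _ _ (by decide)))
          (pat_ne _ _ (by decide)) (pat_ne _ _ (by decide)))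
  · -- `Z = {1,2,2}`: `{0,1,3}, {1,1,2}, {0,2,3}, {1,1,1}` carried — `lemmaY1` + `lemmaW2`
    obtain ⟨a, ha⟩ := hit (P ![0, 1, 3]) (neX _ (pat_ne _ _ (by decide)) (pat_ne _ _ (by decide)))
      (neY _ (pat_ne _ _ (by decide)) (pat_ne _ _ (by decide))) (pat_ne _ _ (by decide))
    obtain ⟨b, hb⟩ := hit (P ![0, 2, 3]) (neX _ (pat_ne _ _ (by decide)) (pat_ne _ _ (by decide)))
      (neY _ (pat_ne _ _ (by decide)) (pat_ne _ _ (by decide))) (pat_ne _ _ (by decide))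
    obtain ⟨c, hc⟩ := hit (P ![1, 1, 2]) (neX _ (pat_ne _ _ (by decide)) (pat_ne _ _ (by decide)))
      (neY _ (pat_ne _ _ (by decide)) (pat_ne _ _ (by decide))) (pat_ne _ _ (by decide))
    obtain ⟨q, hq⟩ := hit (P ![1, 1, 1]) (neX _ (pat_ne _ _ (by decide)) (pat_ne _ _ (by decide)))
      (neY _ (pat_ne _ _ (by decide)) (pat_ne _ _ (by decide))) (pat_ne _ _ (by decide))
    exact lemmaW2 r g h1 hinv h2 h6 h7 h8 (Y1 a c ha hc) b q hb hq

end SymmetricThreeFourFifteen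

open SymmetricThreeFour SymmetricThreeFourSeventeen SymmetricThreeFourSixteen SymmetricThreeFourFifteen

/-- **`T_sym(3,4) ≤ 15` ON EVERY SUPPORT.**  A SYMMETRIC `3 × 3` dominance design with four slope classes (symmetric valuations and signs;
any exponents `d`) has at most `15` sign-alternating uniquely dominant breakpoints along increasing integer slopes — SHARP (`15` is attained
on `d = (0,1,4,13)`, p469079).  Face-free proof («Lemma Z»): classes relabelled by a sorting bijection of the exponents; the sign-free
exclusion lemmas X/Y/W/V leave two mirror-image 17-term configurations, each containing an identity term immediately followed (or preceded)
by the three crossing terms that fix, column by column, its own diagonal letters — whose four signs cannot alternate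
(`termSign_one_eq`, `termSign_swap_symm_three`).  Improves the kernel ceilings `18` (p459728), `17` (p481791), `16` (p484569).
[cell statement R1668; folklore-level exchange and sign arguments] -/
theorem tropRow_three_four_symm_le_fifteen (d : Fin 4 → ℕ) (v ε : Fin 3 → Fin 3 → Fin 4 → ℤ)
    (hv : ∀ i j l, v i j l = v j i l) (hεs : ∀ i j l, ε i j l = ε j i l)
    (n : ℕ) (θ : Fin (n + 1) → ℤ) (p : Fin (n + 1) → Equiv.Perm (Fin 3) × (Fin 3 → Fin 4))
    (hθ : StrictMono θ) (hdom : ∀ k, IsDominant d v ε (θ k) (p k))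
    (halt : ∀ k : Fin n, termSign ε (p k.castSucc) * termSign ε (p k.succ) < 0) : n ≤ 15 := by
  have hinj : Function.Injective p := stub_dominantInjective 3 4 d v ε n θ p hθ hdom halt
  -- classes relabelled by a sorting bijection `σ` of the exponents: rank `σ.symm l`, exponents-by-rank `g = d ∘ σ` (monotone)
  set σ : Equiv.Perm (Fin 4) := Tuple.sort d with hσ
  have hmono : Monotone (d ∘ σ) := Tuple.monotone_sort d
  have hgπ : ∀ l, (d ∘ σ) (σ.symm l) = d l := fun l => by simp
  have hπle : ∀ {l l' : Fin 4}, d l < d l' → σ.symm l ≤ σ.symm l' := by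
    intro l l' h
    by_contra hle
    push Not at hle
    have := hmono hle.le
    rw [hgπ, hgπ] at this
    omega
  have hpk : ∀ k, p k = ((p k).1, (p k).2) := fun k => rfl
  -- cycle-constancy and involutivity of every dominant term (symmetry)
  have hsym : ∀ k, (∀ i, (p k).1 ((p k).1 i) = i) ∧ ∀ i, (p k).2 ((p k).1 i) = (p k).2 i := fun k =>
    isDominant_symm_involutive d v ε hv hεs (θ k) (p k).1 (p k).2 (hdom k)
  -- carriers: identity or a transposition with cycle-constant classes
  have hcar : ∀ k, (p k).1 = 1 ∨ ∃ i j : Fin 3, i < j ∧ (p k).1 = Equiv.swap i j ∧ (p k).2 i = (p k).2 j :=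
    fun k => dominant_symm_three_cases d v ε hv hεs (θ k) (p k).1 (p k).2 (hdom k)
  have hslope : ∀ k, TropicalCensus.slope d (p k) = TropicalCensus.slope (d ∘ σ) ((p k).1, fun i => σ.symm ((p k).2 i)) := by
    intro k
    unfold TropicalCensus.slope
    simp only [hgπ]
  refine SymmetricThreeFourFifteen.core n (fun k => ((p k).1, fun i => σ.symm ((p k).2 i))) (d ∘ σ) hmono
    (fun k => termSign ε (p k)) (fun l x => ε l l (σ x)) (fun k i => ?_) (fun k i => (hsym k).1 i) (fun a b hab i hτ => ?_) ?_
    (fun a b hab => ?_) (fun a b hab ha1 i j hij hbi hbj => ?_) (fun a b hab hb1 i j hij hai haj => ?_) (fun a ha1 => ?_)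
    (fun a k hne hk t => ?_) halt
  · -- cycle-constant classes
    show σ.symm ((p k).2 ((p k).1 i)) = σ.symm ((p k).2 i)
    rw [(hsym k).2]
  · -- same row at column `i` ⇒ non-decreasing rank there (single-entry exchange)
    change (p a).1 i = (p b).1 i at hτ
    show σ.symm ((p a).2 i) ≤ σ.symm ((p b).2 i)
    by_cases h : (p a).2 i = (p b).2 i
    · rw [h]
    · exact hπle (d_lt_of_dominant_entry d v ε (hθ hab) (p a).1 (p b).1 (p a).2 (p b).2 (hdom a) (hdom b) i hτ h)
  · -- the rank multisets are pairwise distinct (slopes strictly increase)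
    have key : ∀ a b : Fin (n + 1), a < b →
        TropicalCensus.classSym ((p a).1, fun i => σ.symm ((p a).2 i)) ≠
          TropicalCensus.classSym ((p b).1, fun i => σ.symm ((p b).2 i)) := by
      intro a b hlt heq
      have h1 := slope_lt_of_dominant d v ε (hθ hlt) (fun e => (ne_of_lt hlt) (hinj e)) (hdom a) (hdom b)
      rw [hslope, hslope, slope_eq_of_classSym, slope_eq_of_classSym, heq] at h1
      exact lt_irrefl _ h1
    intro a b hab
    change TropicalCensus.classSym ((p a).1, fun i => σ.symm ((p a).2 i)) =
      TropicalCensus.classSym ((p b).1, fun i => σ.symm ((p b).2 i)) at hab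
    rcases lt_trichotomy a b with h | h | h
    · exact absurd hab (key a b h)
    · exact h
    · exact absurd hab.symm (key b a h)
  · -- slopes strictly increase
    show TropicalCensus.slope (d ∘ σ) ((p a).1, fun i => σ.symm ((p a).2 i)) <
      TropicalCensus.slope (d ∘ σ) ((p b).1, fun i => σ.symm ((p b).2 i))
    rw [← hslope, ← hslope]
    exact slope_lt_of_dominant d v ε (hθ hab) (fun e => (ne_of_lt hab) (hinj e)) (hdom a) (hdom b)
  · -- identity term before a crossing term: cancellation (C)
    change (p a).1 = 1 at ha1
    change (p b).1 i = j at hbi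
    change (p b).1 j = i at hbj
    show (d ∘ σ) (σ.symm ((p a).2 i)) + (d ∘ σ) (σ.symm ((p a).2 j)) < 2 * (d ∘ σ) (σ.symm ((p b).2 i))
    rw [hgπ, hgπ, hgπ]
    have hDa : IsDominant d v ε (θ a) (1, (p a).2) := by rw [← ha1]; exact hdom a
    have hC := d_add_d_lt_of_dominant_cross d v ε (hθ hab) 1 (p b).1 (p a).2 (p b).2 hDa (hdom b) hij
      (by rw [hbi, Equiv.Perm.one_apply]) (by rw [hbj, Equiv.Perm.one_apply])
    have hji : (p b).2 j = (p b).2 i := by rw [← hbi, (hsym b).2]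
    rw [hji] at hC
    omega
  · -- crossing term before an identity term
    change (p b).1 = 1 at hb1
    change (p a).1 i = j at hai
    change (p a).1 j = i at haj
    show 2 * (d ∘ σ) (σ.symm ((p a).2 i)) < (d ∘ σ) (σ.symm ((p b).2 i)) + (d ∘ σ) (σ.symm ((p b).2 j))
    rw [hgπ, hgπ, hgπ]
    have hDb : IsDominant d v ε (θ b) (1, (p b).2) := by rw [← hb1]; exact hdom b
    have hC := d_add_d_lt_of_dominant_cross d v ε (hθ hab) (p a).1 1 (p a).2 (p b).2 (hdom a) hDb hij
      (by rw [haj, Equiv.Perm.one_apply]) (by rw [hai, Equiv.Perm.one_apply])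
    have hji : (p a).2 j = (p a).2 i := by rw [← hai, (hsym a).2]
    rw [hji] at hC
    omega
  · -- sign of an identity term: the product of its diagonal letters
    change (p a).1 = 1 at ha1
    show termSign ε (p a) = ∏ k, ε k k (σ (σ.symm ((p a).2 k)))
    simp only [Equiv.apply_symm_apply]
    rw [hpk a, ha1]
    exact termSign_one_eq ε (p a).2
  · -- sign of a crossing term: opposite to its fixed diagonal letter
    change (p a).1 ≠ 1 at hne
    change (p a).1 k = k at hk
    show termSign ε (p a) * t < 0 ↔ -ε k k (σ (σ.symm ((p a).2 k))) * t < 0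
    simp only [Equiv.apply_symm_apply]
    rcases hcar a with h | ⟨i, j, hij, hswap, hcc⟩
    · exact absurd h hne
    · have hki : k ≠ i := by
        intro hq; subst hq
        rw [hswap, Equiv.swap_apply_left] at hk
        exact (ne_of_lt hij) hk.symm
      have hkj : k ≠ j := by
        intro hq; subst hq
        rw [hswap, Equiv.swap_apply_right] at hk
        exact (ne_of_lt hij) hk
      have hpres : ε i j ((p a).2 i) ≠ 0 := by
        have := present_of_termSign_ne_zero ε (p a) (hdom a).1 j
        rw [hswap, Equiv.swap_apply_right, ← hcc] at this
        exact this
      rw [hpk a, hswap]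
      exact termSign_swap_mul_neg_iff ε hεs (ne_of_lt hij) hki hkj (p a).2 hcc hpres t

/-- **`TropRootLawAtSymm 3 4 15`** — the row predicate of p473280 at the cell value. [restatement] -/
theorem tropRootLawAtSymm_three_four_fifteen : Orbit.TropRootLawAtSymm 3 4 15 :=
  fun d v ε hv hε n θ p hθ hdom halt => tropRow_three_four_symm_le_fifteen d v ε hv hε n θ p hθ hdom halt

/-- **The symmetric single-term `(3,4)` tropical row is SETTLED in the kernel: `TropRootLawAtSymm 3 4 B ↔ 15 ≤ B`** (ceiling: this file;
floor: the `(0,1,4,13)` design of p469079 via `fifteen_le_of_tropRootLawAtSymm`).  `T^single_sym(3,4) = 15`. [p469079 + this file] -/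
theorem tropRootLawAtSymm_three_four_iff (B : ℕ) : Orbit.TropRootLawAtSymm 3 4 B ↔ 15 ≤ B :=
  ⟨fifteen_le_of_tropRootLawAtSymm, fun hB d v ε hv hε n θ p hθ hdom halt =>
    (tropRow_three_four_symm_le_fifteen d v ε hv hε n θ p hθ hdom halt).trans hB⟩

end Summit.ValiantsHypothesis.ValiantsHypothesis.Theorems.KPlusLogSqLaw
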